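import Summits.BirchSwinnertonDyer.BirchSwinnertonDyer.Theorems.GenusKolyvaginAtTwoGenusDeepSupplyAtTwoNegDiscNarrowDepthZeroInstance
import Summits.BirchSwinnertonDyer.BirchSwinnertonDyer.Theorems.GenusKolyvaginAtTwoGenusPrimitiveSupplyAtTwoPosDiscShallowKFourPosCellShaStructure
import Summits.BirchSwinnertonDyer.BirchSwinnertonDyer.Theorems.GenusKolyvaginAtTwoEquivariantChebotarevAtTwoKummerInvariant
import Literature.NumberTheory.EllipticCurves.HeegnerPointsKolyvaginPrimaryLeavesProofs
import Literature.NumberTheory.EllipticCurves.Rank1Residual.Typed.X5DescentSelmer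
import Summits.BirchSwinnertonDyer.BirchSwinnertonDyer.Theorems.GenusKolyvaginAtTwoGenusPrimitiveSupplyAtTwoDescentSignShaOverImagQuadratic
import HarnessLib

/-!
# Route `GenusKolyvaginAtTwo`, crux 25504 (Δ>0 supply), K₄⁺ cell at positive depth: THE KUMMER CLASS OF `y_K / 2^{M₀}` DESCENDS TO A
# DISTINGUISHED NON-ZERO CLASS `s_y ∈ Sel₂(E/ℚ)` — the class of `Sel₂(E/ℚ)` that CAPITULATES in `K`

Seat `bsd-line-gk2-p5` g35 (cell `bsd-f1-sign2`, WIDTH-5 attach), `--supports stmt-BirchSwinnertonDyer-25504 --as helper`.  THEOREMS ONLY (no definition,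
no named fact, no `sorry`).  **BSD is NOT proved by this file, no item is closed, the registered stub C⁺‴ is untouched.**

WHY.  On the K₄⁺ cell (and on K₄) `Sel₂(E_K/K)^{σ₀} = res_K Sel₂(E/ℚ)` has FOUR elements (p766630) and a level-1 deep class `c₁(ℓ)` is `res_K s(ℓ)`
for a unique `s(ℓ) ∈ Sel₂(E/ℚ)` (port of LEAD p767174 §4).  Which of the four?  ONE non-zero class is canonical: with `Q₀ := y_K/2^{M₀} ∈ E(K)`
(`2^{M₀} ∥ y_K`; `Q₀ ∉ 2E(K)`), its Kummer class `κ_K(Q₀) ∈ Sel₂(E_K/K)` is `σ₀`-INVARIANT (`σ₀Q₀ = −Q₀ +` odd torsion, p767194 `frame_of_two_pow_smul`)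
and NON-ZERO, hence **`κ_K(Q₀) = res_K s_y` for a unique `s_y ∈ Sel₂(E/ℚ)`, `s_y ≠ 0`** — the Mordell–Weil line of `E(K)` seen in `Sel₂(E/ℚ)`;
`res_K s_y` is a Kummer class, so `s_y` dies in `Ш(E/K)`: it spans the capitulation kernel `H¹(Gal(K/ℚ), E(K)) ≅ ℤ/2` on the cell.  So the three
non-zero classes of `Sel₂(E/ℚ)` split as `{s_y} ⊔ {two classes surviving in Ш(E_K/K)[2]}`, and a deep class `c₁(ℓ)` realises `s_y` iff
`P(ℓ) ≡ Q₀ (mod 2E(K[ℓ]))`, a surviving class iff its image `d(ℓ) ∈ H¹(K, E)[2]` is non-zero.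

* §1 (`E(K)`-frame, sign-free) `conjAct_kummerMapTorsion_eq_self_of_frame` — `P ∈ E(K)` Heegner, `w(E) = +1`, `E(K)[2] = 0`, `2^M Q₀ = P`, `τ ≠ 1`:
  `τ_* κ₂(Q₀) = κ₂(Q₀)` (`τQ₀ − Q₀ = −2Q₀ + u`, `u` odd torsion `∈ 2E(K)`); `kummerMapTorsion_ne_zero_of_frame` — `Q₀ ∉ 2E(K) ⟹ κ₂(Q₀) ≠ 0`;
  `kummerMapTorsion_mem_selmerGroup` is the tree's.
* §2 (K₄⁺ cell) **`existsUnique_resTorsion_eq_kummer_of_kFourPos`** — a UNIQUE `s_y ∈ H¹(ℚ, E[2])` with `res_K s_y = κ₂(Q₀)`; `s_y ∈ Sel₂(E/ℚ)`,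
  `s_y ≠ 0` (p766630 unique descent; UNCONDITIONAL).
* §3 (cruxes' currency) **`existsUnique_resTorsion_eq_kummer_of_depth_pos`** — habitat-type hypotheses (`r_an = 0`, `ρ̄₂` onto, `d_KΔ ∉ ℚ²`), `d₁`,
  `2^{M₀} ∣ P(1)`, `2^{M₀+1} ∤ P(1)` in `E(K[1])` (McCallum's normal form): `P₀, Q₀ ∈ E(K)`, `2^{M₀}Q₀ = P₀ ↦ P(1)`, `Q₀ ∉ 2E(K)`, and the class `s_y`.

References: [GrossLMS1991] §4 (4.1), §5 Prop. 5.3, (5.1); [McCallumLMS1991] §5 Lemma 5.1; [Kramer1981] Thm. 1; [SilvermanAEC2009] VIII.§2, X.4.2;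
[Darmon2004] Prop. 3.11.
-/

set_option linter.dupNamespace false -- `Summit.<P>.<Sub>` repeats `BirchSwinnertonDyer` (D-0017)
set_option autoImplicit false

noncomputable section

open scoped Classical NumberField

namespace Summit.BirchSwinnertonDyer.BirchSwinnertonDyer.Theorems.GenusSupplyNarrow.KFourPosCell

open WeierstrassCurve NumberField IsDedekindDomain Field Function
open Literature.NumberTheory.EllipticCurves Literature.NumberTheory.GaloisRepresentations
open Literature.NumberTheory.GaloisCohomology Literature.NumberTheory.EllipticCurves.ModularForms
open Summit.BirchSwinnertonDyer.BirchSwinnertonDyer.Theorems.GenusSupplyNarrow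

variable (W : WeierstrassCurve ℚ) [W.IsElliptic] [W.IsGloballyMinimal] (K : Type) [Field K] [NumberField K]

/-! ## §1 The Kummer class of `Q₀ = P/2^M` is `Aut(K/ℚ)`-invariant and non-zero -/

/-- **`τ_* κ₂(Q₀) = κ₂(Q₀)`** for the `E(K)`-frame of `SwapRead.frame_of_two_pow_smul`: `P ∈ E(K)` Heegner, `w(E) = +1`, `E(K)[2] = 0`,
`2^M • Q₀ = P`, `τ ≠ 1` in `Aut(K/ℚ)`.  Indeed `τQ₀ = −Q₀ + u` with `u` torsion of odd order... precisely `u ∈ E(K)` torsion and `E(K)[2] = 0`, so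
`u ∈ 2E(K)` and `τQ₀ − Q₀ = 2(−Q₀ + u/2) ∈ ker κ₂`; and `τ_* κ(Q₀) = κ(τQ₀)` (tree `conjAct_kummerMapTorsion`).
[cite: GrossLMS1991, §5 Prop. 5.3, (5.1)] [cite: SilvermanAEC2009, VIII.§2] -/
theorem conjAct_kummerMapTorsion_eq_self_of_frame [NeZero (W.conductorNorm ℤ)]
    (hK : IsImaginaryQuadratic K) (hH : SatisfiesHeegnerHypothesis (W.conductorNorm ℤ) K)
    {P : (W.baseChange K).toAffine.Point} (hP : IsHeegnerPoint (W.conductorNorm ℤ) W K P) (hw1 : W.rootNumber = 1)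
    (h2K : ∀ T : (W.baseChange K).toAffine.Point, (2 : ℤ) • T = 0 → T = 0)
    {τ : K ≃ₐ[ℚ] K} (hτ1 : τ ≠ 1) {M : ℕ} {Q₀ : (W.baseChange K).toAffine.Point} (hQ₀ : ((2 ^ M : ℕ) : ℤ) • Q₀ = P) :
    conjAct W τ ((2 : ℕ) : ℤ) (kummerMapTorsion (W.baseChange K) ((2 : ℕ) : ℤ) (GenusKolyArch.hdiv_two_baseChange W K) Q₀) =
      kummerMapTorsion (W.baseChange K) ((2 : ℕ) : ℤ) (GenusKolyArch.hdiv_two_baseChange W K) Q₀ := by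
  -- any `γ ∈ Γ_ℚ` acting as `τ` on `K` will do for the `E(K)`-level facts; take one (they exist: `τ` extends to `ℚ̄`)
  have h2 : Module.finrank ℚ K = 2 := hK.1
  -- `u := τQ₀ + Q₀` is torsion (from the frame; we only need the `E(K)`-level clauses, obtained with a dummy `γ`:
  -- use the algebraic facts directly)
  haveI : Algebra.IsQuadraticExtension ℚ K := ⟨h2⟩
  haveI : IsGalois ℚ K := inferInstance
  -- Gross 5.3 / Darmon 3.11 as packaged in `frame_of_two_pow_smul` needs a `γ`; extract the torsion of `u` by hand instead:
  have hσ : (τ : K →ₐ[ℚ] K) ≠ AlgHom.id ℚ K := fun h ↦ hτ1 (AlgEquiv.ext fun x ↦ DFunLike.congr_fun h x)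
  have ht₀fin : IsOfFinAddOrder (τ • P + P) := by
    have h := heegnerPoint_conj_add_rootNumber_smul.apply heegnerPoint_conj_add_rootNumber_smul_holds hK hH hP hσ
    rwa [hw1, one_smul, ← WeierstrassCurve.smul_def W K τ P] at h
  set u : (W.baseChange K).toAffine.Point := τ • Q₀ + Q₀ with hu
  have hτM : τ • (((2 ^ M : ℕ) : ℤ) • Q₀) = ((2 ^ M : ℕ) : ℤ) • (τ • Q₀) := map_zsmul (DistribSMul.toAddMonoidHom _ τ) _ Q₀
  have hMu : ((2 ^ M : ℕ) : ℤ) • u = τ • P + P := by rw [hu, smul_add, ← hτM, hQ₀]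
  have hufin : IsOfFinAddOrder u := by
    obtain ⟨n, hn, hnt⟩ := (isOfFinAddOrder_iff_nsmul_eq_zero).mp ht₀fin
    refine (isOfFinAddOrder_iff_nsmul_eq_zero).mpr ⟨n * 2 ^ M, Nat.mul_pos hn (Nat.pos_of_ne_zero (pow_ne_zero M two_ne_zero)), ?_⟩
    rw [mul_nsmul', ← natCast_zsmul u (2 ^ M), hMu, hnt]
  -- `u` has odd order, hence is `2`-divisible in `E(K)`
  have hodd : Odd (addOrderOf u) := DepthZero.odd_addOrderOf_of_two_torsionFree hufin fun k hk ↦ h2K _ hk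
  obtain ⟨uh, huh⟩ : ∃ uh : (W.baseChange K).toAffine.Point, (2 : ℤ) • uh = u :=
    ⟨(((addOrderOf u + 1) / 2 : ℕ) : ℤ) • u, two_smul_half_of_odd_addOrderOf hodd⟩
  -- `τQ₀ − Q₀ = 2 • (uh − Q₀)` lies in the kernel of `κ₂`
  have hdiff : Affine.Point.map (W' := W) (τ : K →ₐ[ℚ] K) Q₀ - Q₀ = ((2 : ℕ) : ℤ) • (uh - Q₀) := by
    rw [← WeierstrassCurve.smul_def W K τ Q₀, Nat.cast_ofNat, smul_sub, huh, hu]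
    abel
  have hker : Affine.Point.map (W' := W) (τ : K →ₐ[ℚ] K) Q₀ - Q₀ ∈
      (kummerMapTorsion (W.baseChange K) ((2 : ℕ) : ℤ) (GenusKolyArch.hdiv_two_baseChange W K)).ker := by
    rw [kummerMapTorsion_ker]
    exact ⟨uh - Q₀, hdiff.symm⟩
  rw [conjAct_kummerMapTorsion W τ _ (GenusKolyArch.hdiv_two_baseChange W K) Q₀]
  have h0 := (AddMonoidHom.mem_ker).mp hker
  rw [map_sub, sub_eq_zero] at h0
  exact h0

omit [W.IsElliptic] [W.IsGloballyMinimal] in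
/-- **`κ₂(Q₀) ≠ 0` when `Q₀ ∉ 2E(K)`** (`ker κ₂ = 2E(K)`). [cite: SilvermanAEC2009, VIII.§2, Thm. X.4.2(a)] -/
theorem kummerMapTorsion_ne_zero_of_frame {Q₀ : (W.baseChange K).toAffine.Point}
    (hQ₀ : ¬ ∃ R : (W.baseChange K).toAffine.Point, (2 : ℤ) • R = Q₀) :
    kummerMapTorsion (W.baseChange K) ((2 : ℕ) : ℤ) (GenusKolyArch.hdiv_two_baseChange W K) Q₀ ≠ 0 :=
  GenusExact.kummerMapTorsion_ne_zero_of_not_exists (hdiv := GenusKolyArch.hdiv_two_baseChange W K)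
    (by simpa only [Nat.cast_ofNat] using hQ₀)

/-! ## §2 On the K₄⁺ cell: the distinguished class `s_y ∈ Sel₂(E/ℚ)` -/

/-- **THE KUMMER CLASS OF `Q₀ = P/2^M` DESCENDS TO A UNIQUE NON-ZERO `s_y ∈ Sel₂(E/ℚ)` ON THE K₄⁺ CELL.**  Cell: `W/ℚ` globally minimal, `Δ > 0`,
`ρ̄_{E,2}` onto, `∏ c(E)` odd, `#Sel₂(E) = 4 ∧ ∃ c ∈ Sel₂(E), loc_∞ c ≠ 0`; `K` imaginary quadratic, `d_K` odd, Heegner, `2` split; `Wd = Cd • E^{(d_K)}`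
elliptic with `ord₂ C(Wd) = 0`; `τ ≠ 1`; `P ∈ E(K)` Heegner, `w(E) = +1`, `2^M Q₀ = P`, `Q₀ ∉ 2E(K)`.  Then **there is a unique
`s_y ∈ H¹(ℚ, E[2])` with `res_K s_y = κ₂(Q₀)`; `s_y ∈ Sel₂(E/ℚ)` and `s_y ≠ 0`** (§1 + the tree's `kummerMapTorsion_mem_selmerGroup` + p766630
`existsUnique_mem_selmerGroup_resTorsion_eq_of_kFourPos`; `res_K` injective).  `res_K s_y` is a Kummer class over `K`: `s_y` is the class of
`Sel₂(E/ℚ)` that capitulates in `K`.  UNCONDITIONAL. [cite: Kramer1981, Thm. 1] [cite: GrossLMS1991, §5 (5.1), Prop. 5.3] [cite: SilvermanAEC2009, Thm. X.4.2(a)] -/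
theorem existsUnique_resTorsion_eq_kummer_of_kFourPos [NeZero (W.conductorNorm ℤ)]
    (hpos : 0 < W.Δ) (hs2 : W.HasSurjectiveModNGaloisRep 2) (hTam : Odd W.tamagawaProduct)
    (h4 : Nat.card (W.selmerGroup 2) = 4 ∧ ∃ c ∈ (W.kummerSelmerStructure ((2 : ℕ) : ℤ)).selmerGroup,
      galoisCohomology.localization (W.torsionGaloisModule ((2 : ℕ) : ℤ)) (Sum.inl Rat.infinitePlace) 1 c ≠ 0)
    (hK : IsImaginaryQuadratic K) (hodd : Odd (discr K)) (hH : SatisfiesHeegnerHypothesis (W.conductorNorm ℤ) K)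
    (h2K : ((Ideal.span {(2 : ℤ)}).primesOver (𝓞 K)).ncard = 2)
    {Wd : WeierstrassCurve ℚ} [Wd.IsElliptic] (Cd : VariableChange ℚ) (hCd : Cd • W.quadraticTwist (discr K : ℚ) = Wd)
    (hDEF : padicValNat 2 Wd.tamagawaProduct = 0) {τ : K ≃ₐ[ℚ] K} (hτ1 : τ ≠ 1)
    {P : (W.baseChange K).toAffine.Point} (hP : IsHeegnerPoint (W.conductorNorm ℤ) W K P) (hw1 : W.rootNumber = 1)
    {M : ℕ} {Q₀ : (W.baseChange K).toAffine.Point} (hQ₀ : ((2 ^ M : ℕ) : ℤ) • Q₀ = P)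
    (hndiv : ¬ ∃ R : (W.baseChange K).toAffine.Point, (2 : ℤ) • R = Q₀) :
    (∃! s : galH1Torsion W ((2 : ℕ) : ℤ),
        resTorsion W K ((2 : ℕ) : ℤ) s = kummerMapTorsion (W.baseChange K) ((2 : ℕ) : ℤ) (GenusKolyArch.hdiv_two_baseChange W K) Q₀ ∧
          s ∈ W.selmerGroup ((2 : ℕ) : ℤ)) ∧
      ∀ s : galH1Torsion W ((2 : ℕ) : ℤ),
        resTorsion W K ((2 : ℕ) : ℤ) s = kummerMapTorsion (W.baseChange K) ((2 : ℕ) : ℤ) (GenusKolyArch.hdiv_two_baseChange W K) Q₀ → s ≠ 0 := by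
  have h2 : Module.finrank ℚ K = 2 := hK.1
  have h2T := forall_two_smul_eq_zero_baseChange_of_kFourPos W K hs2 h2
  have h2T' : ∀ T : (W.baseChange K).toAffine.Point, (2 : ℤ) • T = 0 → T = 0 := fun T hT ↦ h2T T (by simpa using hT)
  have hfix := conjAct_kummerMapTorsion_eq_self_of_frame W K hK hH hP hw1 h2T' hτ1 hQ₀
  have hSel := (W.baseChange K).kummerMapTorsion_mem_selmerGroup ((2 : ℕ) : ℤ) (GenusKolyArch.hdiv_two_baseChange W K) Q₀
  have hne := kummerMapTorsion_ne_zero_of_frame W K hndiv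
  refine ⟨existsUnique_mem_selmerGroup_resTorsion_eq_of_kFourPos W K hpos hs2 hTam h4 hK hodd hH h2K Cd hCd hDEF hτ1 hSel hfix,
    fun s hs h0 ↦ hne ?_⟩
  rw [← hs, h0, map_zero]

/-! ## §3 In the cruxes' currency: `Q₀ = y_K/2^{M₀}` at McCallum's exponent -/

/-- **ON THE K₄⁺ CELL OF CRUX 25504, AT McCALLUM'S EXPONENT `M₀`, THE CLASS OF `y_K/2^{M₀}` IS A DISTINGUISHED NON-ZERO ELEMENT OF `Sel₂(E/ℚ)`.**
Habitat-type hypotheses: `r_an(E) = 0`, `ρ̄_{E,2}` onto, `d_K·Δ_E ∉ ℚ²`, `∏ c(E)` odd, `Δ > 0`, the K₄⁺ clause; `K` imaginary quadratic, `d_K` odd,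
Heegner, `2` split, `τ ≠ 1`; `Wd = Cd • E^{(d_K)}` with `ord₂ C(Wd) = 0`; a conductor-`1` datum `d₁` and McCallum's normal form `2^{M₀} ∣ P(1)`,
`2^{M₀+1} ∤ P(1)` in `E(K[1])`.  Then there are `P₀, Q₀ ∈ E(K)` with `P₀ ↦ P(1)` Heegner, `2^{M₀}Q₀ = P₀`, `Q₀ ∉ 2E(K)` (McCallum 5.1 both ways),
and a UNIQUE `s_y ∈ H¹(ℚ, E[2])` with `res_K s_y = κ₂(Q₀)`, `s_y ∈ Sel₂(E/ℚ)`, `s_y ≠ 0`.  READING: the Mordell–Weil line of `E(K)` occupies ONE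
of the three non-zero classes of `Sel₂(E/ℚ) ≅ Ш(E/ℚ)[2]`; a deep class `c₁(ℓ) = res_K s(ℓ)` (p767174/K₄⁺ port) realises `s_y` iff
`P(ℓ) ≡ Q₀ mod 2E(K[ℓ])`.  UNCONDITIONAL.  BSD is NOT proved by this.
[cite: GrossLMS1991, §4 (4.1), §5 Prop. 5.3] [cite: McCallumLMS1991, §5 Lemma 5.1] [cite: Kramer1981, Thm. 1] [cite: SilvermanAEC2009, Thm. X.4.2(a)] -/
theorem existsUnique_resTorsion_eq_kummer_of_depth_pos [NeZero (W.conductorNorm ℤ)]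
    (hpos : 0 < W.Δ) (hs2 : W.HasSurjectiveModNGaloisRep 2) (hTam : Odd W.tamagawaProduct)
    (h4 : Nat.card (W.selmerGroup 2) = 4 ∧ ∃ c ∈ (W.kummerSelmerStructure ((2 : ℕ) : ℤ)).selmerGroup,
      galoisCohomology.localization (W.torsionGaloisModule ((2 : ℕ) : ℤ)) (Sum.inl Rat.infinitePlace) 1 c ≠ 0)
    (hK : IsImaginaryQuadratic K) (hodd : Odd (discr K)) (hH : SatisfiesHeegnerHypothesis (W.conductorNorm ℤ) K)
    (h2K : ((Ideal.span {(2 : ℤ)}).primesOver (𝓞 K)).ncard = 2)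
    {Wd : WeierstrassCurve ℚ} [Wd.IsElliptic] (Cd : VariableChange ℚ) (hCd : Cd • W.quadraticTwist (discr K : ℚ) = Wd)
    (hDEF : padicValNat 2 Wd.tamagawaProduct = 0) {τ : K ≃ₐ[ℚ] K} (hτ1 : τ ≠ 1)
    (hr0 : W.analyticRank = 0) (hsq : ¬ IsSquare ((NumberField.discr K : ℚ) * W.Δ))
    (Dt : ModularParametrizationData W (W.conductorNorm ℤ)) (β : ℤ) (ι : K →+* ℂ) (d₁ : KolyvaginHeegnerData Dt β ι 1)
    {M₀ : ℕ} (hdiv : ∃ Q : (W.baseChange (ringClassField K ι 1)).toAffine.Point, ((2 ^ M₀ : ℕ) : ℤ) • Q = d₁.derivedPoint)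
    (hndiv : ¬ ∃ Q : (W.baseChange (ringClassField K ι 1)).toAffine.Point, ((2 ^ (M₀ + 1) : ℕ) : ℤ) • Q = d₁.derivedPoint) :
    ∃ P₀ Q₀ : (W.baseChange K).toAffine.Point, IsHeegnerPoint (W.conductorNorm ℤ) W K P₀ ∧
      Affine.Point.map (W' := W) (algebraMap K (ringClassField K ι 1)).toRatAlgHom P₀ = d₁.derivedPoint ∧
      ((2 ^ M₀ : ℕ) : ℤ) • Q₀ = P₀ ∧ (¬ ∃ R : (W.baseChange K).toAffine.Point, (2 : ℤ) • R = Q₀) ∧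
      (∃! s : galH1Torsion W ((2 : ℕ) : ℤ),
        resTorsion W K ((2 : ℕ) : ℤ) s = kummerMapTorsion (W.baseChange K) ((2 : ℕ) : ℤ) (GenusKolyArch.hdiv_two_baseChange W K) Q₀ ∧
          s ∈ W.selmerGroup ((2 : ℕ) : ℤ)) ∧
      ∀ s : galH1Torsion W ((2 : ℕ) : ℤ),
        resTorsion W K ((2 : ℕ) : ℤ) s = kummerMapTorsion (W.baseChange K) ((2 : ℕ) : ℤ) (GenusKolyArch.hdiv_two_baseChange W K) Q₀ → s ≠ 0 := by
  -- `E(K[1])[2] = 0`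
  have htors : ∀ T : (W.baseChange (ringClassField K ι 1)).toAffine.Point, (2 : ℤ) • T = 0 → T = 0 := by
    intro T hT
    have h := GenusExact.torsionBy_two_ringClassField_eq_bot W hK ι one_ne_zero hs2 hsq
    have hT' : T ∈ AddSubgroup.torsionBy (W.baseChange (ringClassField K ι 1)).toAffine.Point ((2 : ℕ) : ℤ) :=
      (Submodule.mem_torsionBy_iff _ T).mpr (by exact_mod_cast hT)
    rw [h] at hT'
    exact (AddSubgroup.mem_bot).mp hT'
  -- the Heegner point `P₀ ∈ E(K)` under `P(1)`, `w(E) = +1`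
  obtain ⟨P₀, hP₀H, hP₀⟩ := heegnerSystem_exists_isHeegnerPoint_map_eq_derivedPoint_one
    (heegnerPointOfConductor_one_galoisConj_holds (W.conductorNorm ℤ) W K) hK hH d₁
  have hw1 : W.rootNumber = 1 := W.rootNumber_eq_one_of_even_analyticRank (by rw [hr0]; exact Even.zero)
  -- McCallum 5.1: `2^{M₀} ∣ y_K` in `E(K)`, `2^{M₀+1} ∤ y_K` in `E(K)`
  have hdivK : ∃ Q₀ : (W.baseChange K).toAffine.Point, ((2 ^ M₀ : ℕ) : ℤ) • Q₀ = P₀ := by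
    obtain ⟨Q, hQ⟩ := hdiv
    obtain ⟨Q₀, hQ₀⟩ := (McCallum1991.exists_pow_smul_eq_derivedPoint_one_iff hK d₁ (p := 2) htors hP₀ M₀).mp
      ⟨Q, by simpa only [Nat.cast_pow, Nat.cast_ofNat] using hQ⟩
    exact ⟨Q₀, by simpa only [Nat.cast_pow, Nat.cast_ofNat] using hQ₀⟩
  have hndivK : ¬ ∃ Q₁ : (W.baseChange K).toAffine.Point, ((2 ^ (M₀ + 1) : ℕ) : ℤ) • Q₁ = P₀ := by
    rintro ⟨Q₁, hQ₁⟩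
    refine hndiv ?_
    obtain ⟨Q, hQ⟩ := (McCallum1991.exists_pow_smul_eq_derivedPoint_one_iff hK d₁ (p := 2) htors hP₀ (M₀ + 1)).mpr
      ⟨Q₁, by simpa only [Nat.cast_pow, Nat.cast_ofNat] using hQ₁⟩
    exact ⟨Q, by simpa only [Nat.cast_pow, Nat.cast_ofNat] using hQ⟩
  obtain ⟨Q₀, hQ₀⟩ := hdivK
  have hQ₀ndiv : ¬ ∃ R : (W.baseChange K).toAffine.Point, (2 : ℤ) • R = Q₀ := by
    rintro ⟨R, hR⟩
    refine hndivK ⟨R, ?_⟩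
    have h22 : ((2 ^ (M₀ + 1) : ℕ) : ℤ) = ((2 ^ M₀ : ℕ) : ℤ) * 2 := by push_cast; ring
    rw [h22, mul_smul, hR, hQ₀]
  exact ⟨P₀, Q₀, hP₀H, hP₀, hQ₀, hQ₀ndiv,
    existsUnique_resTorsion_eq_kummer_of_kFourPos W K hpos hs2 hTam h4 hK hodd hH h2K Cd hCd hDEF hτ1 hP₀H hw1 hQ₀ hQ₀ndiv⟩

end Summit.BirchSwinnertonDyer.BirchSwinnertonDyer.Theorems.GenusSupplyNarrow.KFourPosCell

end
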